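import Summits.ResolutionOfSingularities.ResolutionOfSingularities.Theorems.FrobeniusClosingSteerToricExitProducer

/-!
# Crux `Steer` (stmt-ResolutionOfSingularities-16345) — §σ2.28 PROVER'S TOOL, part 3: the RE-CLEANED toric exit producer (ρ₁)

OURS (campaign res-hironaka, rung L ★L-G4, slot W4.1; res-type-028 g10 on res-L0-w41-plan-1 RULING 146b). Theses-free;
`--supports stmt-ResolutionOfSingularities-16345`, counted 0. NOT a statement of the manuscript under review
[claim: Hironaka2017, status: under-review]; AI seat, weaker than expert review.

WHY (res-L0-w41-tri-3 row R-W, plan-1 RULING 146). On specimen f♮'s ray the σ_top run never exits TORICALLY IN THE LETTERS `(s N, x)` of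
`ToricExitAt` (every stage, every regular system of parameters: the class `N_f♮`), yet `Concl` holds, with a regular witness found after
RE-CLEANING the torsor letter — charts in `((s N + g)/monomial, …)` for ONE cleaner `g ∈ R N` chosen at the exit stage (tri-3's regime I
system `{(s+g)/(x₁u₃²), A, β, u₂, u₀}` of determinant `1`, regime II `{(s+g)/(u₀u₂⁵x₃), …}` of determinant `−1`). So the PRODUCER the
T-line wants concludes `Concl O A₀ t` DIRECTLY from a Jacobian unit in a monomial chart of the RE-CLEANED letters `y = (s N + g, x)`.

`concl_of_recleanedJacobianUnit`: MONOMIAL-TYPE member `R N = locAtCentre k[x] O` (`x : Fin n → K` algebraically independent over `k`),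
`g ∈ R N`, letters `y = (s N + g, x)` (`s N + g ≠ 0`, `k(y) = K`, `trdeg_k K = n`), a unimodular `m` with `m⁻¹ ≥ 0` (cone inside the positive
orthant) and all `z_j = y^{m_j} ∈ O`, a relation `G ∈ k[Z₀..Z_n]` with `G(z) = 0` and a JACOBIAN UNIT, `A₀` finitely generated with
`A₀ ≤ R N`, and `t` in `(R N)[s N]` (the run's `SteeredExit.mem_closure_insert_of_steps`) ⇒ `Concl O A₀ t`. Proof: (E2) `concl_of_jacobianUnit`
with the sandwich `A₀ ≤ R N = locAtCentre k[x] O ≤ locAtCentre k[z] O` (`x_i ∈ k[z]` because `m⁻¹ ≥ 0`) and `s N = y₀ − g ∈ locAtCentre k[z] O`.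
The case `g = 0` (`concl_of_toricJacobianUnit`) is the un-recleaned producer of `Concl` matching (E3). [folklore] [cite: Teissier2014]
-/

noncomputable section

-- single-problem summit: the doubled namespace component `ResolutionOfSingularities` is forced
set_option linter.dupNamespace false

open scoped BigOperators

namespace Summit.ResolutionOfSingularities.ResolutionOfSingularities.Theorems.SteerToricExitCriterion

open IsLocalRing MvPolynomial
open Literature.AlgebraicGeometry.Resolution

variable {k K : Type} [Field k] [Field K] [Algebra k K]

/-- **(ρ₁) THE RE-CLEANED TORIC EXIT PRODUCER.** Monomial-type member `R N = locAtCentre k[x] O`, a cleaner `g ∈ R N`, re-cleaned letters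
`y = (s N + g, x)` with `s N + g ≠ 0`, `k(y) = K`, `trdeg_k K = n`; unimodular `m` with `m⁻¹ ≥ 0` and all `z_j = y^{m_j} ∈ O`; `G(z) = 0` with
a Jacobian unit; `A₀` finitely generated, `A₀ ≤ R N`; `t ∈ (R N)[s N]`. Then `Concl O A₀ t` — the model is `k[z, gens A₀, t]`, whose local
ring at the centre of `O` is the regular `locAtCentre k[z] O` of (E1). OURS. [folklore] -/
theorem concl_of_recleanedJacobianUnit (O : ValuationSubring K) (hk : ∀ c : k, algebraMap k K c ∈ O)
    {n : ℕ} (x : Fin n → K) (hx : AlgebraicIndependent k x)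
    (R : ℕ → Subring K) (s : ℕ → K) (N : ℕ) (g : K) (hg : g ∈ R N) (hsg : s N + g ≠ 0)
    (hR : R N = locAtCentre (Algebra.adjoin k (Set.range x)).toSubring O)
    (htr : Algebra.trdeg k K = n)
    (hyK : IntermediateField.adjoin k (Set.range (Matrix.vecCons (s N + g) x)) = ⊤)
    (m : Matrix (Fin (n + 1)) (Fin (n + 1)) ℤ) (hm : IsUnit m.det) (hpos : ∀ i j, 0 ≤ m⁻¹ i j)
    (hmO : ∀ j, (∏ i, (Matrix.vecCons (s N + g) x) i ^ m j i) ∈ O)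
    (G : MvPolynomial (Fin (n + 1)) k)
    (hG : MvPolynomial.aeval (fun j => ∏ i, (Matrix.vecCons (s N + g) x) i ^ m j i) G = 0)
    (hJ : ∃ j, O.valuation
      (MvPolynomial.aeval (fun j => ∏ i, (Matrix.vecCons (s N + g) x) i ^ m j i) (MvPolynomial.pderiv j G)) = 1)
    (A₀ : Subalgebra k K) (hA₀ : A₀.FG) (hA₀R : A₀.toSubring ≤ R N)
    (t : K) (ht : t ∈ Subring.closure (insert (s N) (R N : Set K))) :
    SwitchingDichotomy.Words.Concl O A₀ t := by
  classical
  set y : Fin (n + 1) → K := Matrix.vecCons (s N + g) x with hydef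
  set z : Fin (n + 1) → K := fun j => ∏ i, y i ^ m j i with hzdef
  have hy0 : ∀ i, y i ≠ 0 := by
    intro i
    refine Fin.cases ?_ (fun l => ?_) i
    · simpa [hydef] using hsg
    · simpa [hydef] using hx.ne_zero l
  set Bz : Subalgebra k K := Algebra.adjoin k (Set.range z) with hBzdef
  have hyBz : ∀ i, y i ∈ Bz := fun i => letter_mem_adjoin_of_inv_nonneg y hy0 m hm hpos i
  have hzK : IntermediateField.adjoin k (Set.range z) = ⊤ := by
    refine eq_top_iff.mpr ?_
    rw [← hyK]
    refine IntermediateField.adjoin_le_iff.mpr ?_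
    rintro _ ⟨i, rfl⟩
    exact IntermediateField.algebra_adjoin_le_adjoin k _ (hyBz i)
  -- the sandwich: `R N ≤ locAtCentre k[z] O` and `s N ∈ locAtCentre k[z] O`
  have hxBz : Algebra.adjoin k (Set.range x) ≤ Bz := by
    refine Algebra.adjoin_le ?_
    rintro _ ⟨l, rfl⟩
    have := hyBz l.succ
    simpa [hydef] using this
  have hRL : R N ≤ locAtCentre Bz.toSubring O := by
    rw [hR]
    exact locAtCentre_mono O (show (Algebra.adjoin k (Set.range x)).toSubring ≤ Bz.toSubring from hxBz)
  have hsL : s N ∈ locAtCentre Bz.toSubring O := by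
    have h0 : y 0 ∈ Bz := hyBz 0
    have h0' : s N + g ∈ Bz := by simpa [hydef] using h0
    have : s N = (s N + g) - g := by ring
    rw [this]
    exact Subring.sub_mem _ (le_locAtCentre _ O h0') (hRL hg)
  have htL : t ∈ locAtCentre Bz.toSubring O := by
    refine (Subring.closure_le.mpr ?_) ht
    rintro w (rfl | hw)
    · exact hsL
    · exact hRL hw
  exact concl_of_jacobianUnit O hk z hmO hzK htr G hG hJ A₀ hA₀ (hA₀R.trans hRL) t htL

/-- **The un-recleaned `Concl` producer** (`g = 0`): letters `(s N, x)` as in (E3) `toricExitAt_of_jacobianUnit`, concluding `Concl O A₀ t`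
directly (for `A₀ ≤ R N` finitely generated and `t ∈ (R N)[s N]`). OURS. [folklore] -/
theorem concl_of_toricJacobianUnit (O : ValuationSubring K) (hk : ∀ c : k, algebraMap k K c ∈ O)
    {n : ℕ} (x : Fin n → K) (hx : AlgebraicIndependent k x)
    (R : ℕ → Subring K) (s : ℕ → K) (N : ℕ) (hs0 : s N ≠ 0)
    (hR : R N = locAtCentre (Algebra.adjoin k (Set.range x)).toSubring O)
    (htr : Algebra.trdeg k K = n)
    (hyK : IntermediateField.adjoin k (Set.range (Matrix.vecCons (s N) x)) = ⊤)
    (m : Matrix (Fin (n + 1)) (Fin (n + 1)) ℤ) (hm : IsUnit m.det) (hpos : ∀ i j, 0 ≤ m⁻¹ i j)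
    (hmO : ∀ j, (∏ i, (Matrix.vecCons (s N) x) i ^ m j i) ∈ O)
    (G : MvPolynomial (Fin (n + 1)) k)
    (hG : MvPolynomial.aeval (fun j => ∏ i, (Matrix.vecCons (s N) x) i ^ m j i) G = 0)
    (hJ : ∃ j, O.valuation
      (MvPolynomial.aeval (fun j => ∏ i, (Matrix.vecCons (s N) x) i ^ m j i) (MvPolynomial.pderiv j G)) = 1)
    (A₀ : Subalgebra k K) (hA₀ : A₀.FG) (hA₀R : A₀.toSubring ≤ R N)
    (t : K) (ht : t ∈ Subring.closure (insert (s N) (R N : Set K))) :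
    SwitchingDichotomy.Words.Concl O A₀ t := by
  have h0 : (0 : K) ∈ R N := Subring.zero_mem _
  have e : s N + 0 = s N := add_zero _
  exact concl_of_recleanedJacobianUnit O hk x hx R s N 0 h0 (by rwa [e]) hR htr (by rwa [e]) m hm hpos
    (by rw [e]; exact hmO) G (by rw [e]; exact hG) (by rw [e]; exact hJ) A₀ hA₀ hA₀R t ht

end Summit.ResolutionOfSingularities.ResolutionOfSingularities.Theorems.SteerToricExitCriterion

end
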